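import Summits.KontsevichZagierPeriods.KontsevichZagierPeriods.Theorems.RootDecompWalshStrataEtypeFrontier

/-!
# Root decomposition & Walsh strata — E-type assembly III: from one sector to the whole plane (gen 9, §42)

Route `RootDecompWalshStrata`, leaf `QuadricBakerDescent` (stmt-27597), residual R-E2 = the E-type ASSEMBLY
(NODE.md, decomp-kz-lens-4, GEN 9 MENU (1)).  `[U, γ√(a(κ₀X² + κ₁Y²) + c)] ∈ InBaker` (`κ₀, κ₁ > 0`, `a ≠ 0`)
for EVERY bounded open `ℚ`-semialgebraic `U` on which the radicand is positive and whose frontier lies on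
the radicand conic, on genuine rational lines and on good adapted conic walls (`goodWalls`, §40):
`InBaker.of_Esector3` (= §39 on the sector `0 < Y < X`), then cut-and-reflect (rule (1) along a rational line
through the centre, which is null, + the moves `swap` / `negY` / `negX` of rule (2)) through the regions
`{X, Y > 0}` ⊃ `{X > 0}` ⊃ `{Q < 1}` (`InBaker.of_Esector2/1/0`), and a rational dilation for bounded `U`
(`InBaker.of_Eplane`).  [KontsevichZagier2001 §1.2 rules (1)–(2); BCR1998 §2.2; this node]
-/

noncomputable section

open Set MeasureTheory MvPolynomial Literature.NumberTheory.Transcendental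
open Literature.ModelTheory.ExponentialFields (IsSemialgebraic)

namespace Summit.KontsevichZagierPeriods.RootDecompWalshStrata.ConicDescent.BallCube

variable {κ₀ κ₁ : ℚ}

/-! #### 42.1 Cut-and-reflect along a genuine rational line -/

/-- A rational affine form is continuous. [folklore] -/
theorem Wall.continuous_eval (L : Wall) : Continuous fun w : Fin 2 → ℝ => L.eval (w 0) (w 1) := by
  simp only [Wall.eval]; fun_prop

/-- **CUT along a genuine rational line** (rule (1)): `[σ] ∈ InBaker` as soon as the two open pieces
`σ ∩ {L > 0}`, `σ ∩ {L < 0}` are — the line itself is a null zero set. [KontsevichZagier2001 §1.2 rule (1)] -/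
theorem InBaker.of_cut (L : Wall) (hL : L.k1 ≠ 0 ∨ L.k2 ≠ 0) (σ : KZ.IntegralRep 2)
    (hpos : ∀ (T : Set (Fin 2 → ℝ)) (hT : IsSemialgebraic ℚ T) (hTr : T ⊆ σ.domain),
      T = σ.domain ∩ {w | 0 < L.eval (w 0) (w 1)} → InBaker (KZ.of (σ.restrict T hT hTr)))
    (hneg : ∀ (T : Set (Fin 2 → ℝ)) (hT : IsSemialgebraic ℚ T) (hTr : T ⊆ σ.domain),
      T = σ.domain ∩ {w | L.eval (w 0) (w 1) < 0} → InBaker (KZ.of (σ.restrict T hT hTr))) :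
    InBaker (KZ.of σ) := by
  classical
  have hP : IsSemialgebraic ℚ {w : Fin 2 → ℝ | 0 < L.eval (w 0) (w 1)} := by
    simpa only [Conic.aeval_pxyP, Wall.toConic_pxy] using
      Literature.ModelTheory.ExponentialFields.isSemialgebraic_setOf_eval_pos (k := ℚ) (R := ℝ) L.toConic.pxyP
  have hN : IsSemialgebraic ℚ {w : Fin 2 → ℝ | L.eval (w 0) (w 1) < 0} := by
    simpa only [Conic.aeval_pxyP, Wall.toConic_pxy, map_zero] using
      Literature.ModelTheory.ExponentialFields.isSemialgebraic_setOf_eval_lt (k := ℚ) (R := ℝ) L.toConic.pxyP 0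
  have hZ : IsSemialgebraic ℚ {w : Fin 2 → ℝ | L.eval (w 0) (w 1) = 0} := by
    simpa only [Conic.aeval_pxyP, Wall.toConic_pxy] using
      Literature.ModelTheory.ExponentialFields.isSemialgebraic_setOf_eval_eq_zero (k := ℚ) (R := ℝ) L.toConic.pxyP
  have key : ∀ (k : Fin 3) (x : Fin 2 → ℝ),
      x ∈ (![{w | 0 < L.eval (w 0) (w 1)}, {w | L.eval (w 0) (w 1) < 0}, {w | L.eval (w 0) (w 1) = 0}] :
        Fin 3 → Set (Fin 2 → ℝ)) k →
        (k = 0 ∧ 0 < L.eval (x 0) (x 1)) ∨ (k = 1 ∧ L.eval (x 0) (x 1) < 0) ∨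
          (k = 2 ∧ L.eval (x 0) (x 1) = 0) := by
    intro k x hk
    fin_cases k
    · exact Or.inl ⟨rfl, hk⟩
    · exact Or.inr (Or.inl ⟨rfl, hk⟩)
    · exact Or.inr (Or.inr ⟨rfl, hk⟩)
  refine InBaker.of_partition (Finset.univ : Finset (Fin 3)) σ
    ![{w | 0 < L.eval (w 0) (w 1)}, {w | L.eval (w 0) (w 1) < 0}, {w | L.eval (w 0) (w 1) = 0}]
    ?_ ?_ ?_ ?_
  · intro i _
    fin_cases i
    · exact hP
    · exact hN
    · exact hZ
  · intro x _
    rcases lt_trichotomy (L.eval (x 0) (x 1)) 0 with h | h | h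
    · exact ⟨1, Finset.mem_univ _, h⟩
    · exact ⟨2, Finset.mem_univ _, h⟩
    · exact ⟨0, Finset.mem_univ _, h⟩
  · intro i j x hij hi hj
    rcases key i x hi with ⟨rfl, h₁⟩ | ⟨rfl, h₁⟩ | ⟨rfl, h₁⟩ <;>
      rcases key j x hj with ⟨rfl, h₂⟩ | ⟨rfl, h₂⟩ | ⟨rfl, h₂⟩ <;>
      first | exact hij rfl | linarith
  · intro i _ T hT hTr hTeq
    fin_cases i
    · exact hpos T hT hTr hTeq
    · exact hneg T hT hTr hTeq
    · -- the null line
      have hne : ∃ x : Fin 2 → ℝ, aeval x L.toConic.pxyP ≠ 0 := by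
        rcases hL with h1 | h2
        · refine ⟨![(((1 - L.k0) / L.k1 : ℚ) : ℝ), 0], ?_⟩
          rw [Conic.aeval_pxyP, Wall.toConic_pxy, Wall.eval]
          simp only [Matrix.cons_val_zero, Matrix.cons_val_one, mul_zero, add_zero]
          have h1' : (L.k1 : ℝ) ≠ 0 := by exact_mod_cast h1
          rw [show (L.k0 : ℝ) + L.k1 * (((1 - L.k0) / L.k1 : ℚ) : ℝ) = 1 by
            push_cast; field_simp; ring]
          exact one_ne_zero
        · refine ⟨![0, (((1 - L.k0) / L.k2 : ℚ) : ℝ)], ?_⟩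
          rw [Conic.aeval_pxyP, Wall.toConic_pxy, Wall.eval]
          simp only [Matrix.cons_val_zero, Matrix.cons_val_one, mul_zero, add_zero]
          have h2' : (L.k2 : ℝ) ≠ 0 := by exact_mod_cast h2
          rw [show (L.k0 : ℝ) + L.k2 * (((1 - L.k0) / L.k2 : ℚ) : ℝ) = 1 by
            push_cast; field_simp; ring]
          exact one_ne_zero
      refine InBaker.of_subset_zeroSet _ L.toConic.pxyP hne fun v hv => ?_
      have hv' : v ∈ T := hv
      rw [hTeq] at hv'
      rw [Conic.aeval_pxyP, Wall.toConic_pxy]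
      exact hv'.2

/-! #### 42.2 The sector `0 < Y < X` -/

/-- **STAGE 3: an open piece of the sector `0 < Y < X`** (= `InBaker.of_psector_cwalls`, §39, with the
closure as the closed set and the genuine replacement of the line list). [this node] -/
theorem InBaker.of_Esector3 (hκ : 0 < κ₀ ∧ 0 < κ₁) (γ a c : ℚ) (ha : a ≠ 0) {n m : ℕ} (ℓ : Fin n → Wall)
    (q : Fin m → Wall) (hq : ∀ j, q j ∈ goodWalls κ₀ κ₁ a c) (σ : KZ.IntegralRep 2) (hσo : IsOpen σ.domain)
    (hσT : σ.domain ⊆ {w | 0 < w 1 ∧ w 1 < w 0 ∧ (κ₀ : ℝ) * w 0 ^ 2 + κ₁ * w 1 ^ 2 < 1})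
    (hD : ∀ w ∈ σ.domain, 0 < erad κ₀ κ₁ a c w)
    (hσi : ∀ w ∈ σ.domain, σ.integrand w = ellW κ₀ κ₁ γ a c w)
    (hfr : ∀ w ∈ closure σ.domain, w ∉ σ.domain → w ∈ wallLocus (erad κ₀ κ₁ a c) ℓ q) :
    InBaker (KZ.of σ) := by
  classical
  have hκ' : 0 < κ₀ ∧ 0 ≤ κ₁ := ⟨hκ.1, hκ.2.le⟩
  set ℓ' : Fin n → Wall := fun i => if (ℓ i).k1 = 0 ∧ (ℓ i).k2 = 0 then ⟨0, 1, 0⟩ else ℓ i with hℓ'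
  have hℓ0 : ∀ i, (ℓ' i).k0 = 0 → (ℓ' i).k1 ≠ 0 ∨ (ℓ' i).k2 ≠ 0 := by
    intro i _
    by_cases h : (ℓ i).k1 = 0 ∧ (ℓ i).k2 = 0
    · left
      rw [show ℓ' i = ⟨0, 1, 0⟩ from if_pos h]
      exact one_ne_zero
    · rw [show ℓ' i = ℓ i from if_neg h]
      exact not_and_or.1 h
  have hc : c < 0 ∨ (0 < κ₁ ∧ ∀ j, (q j).k0 ^ 2 ≠ c ∧ ((cwall κ₀ κ₁ a c (q j)).δe ≠ 0 →
      (cwall κ₀ κ₁ a c (q j)).δg - (cwall κ₀ κ₁ a c (q j)).δf ^ 2 / (4 * (cwall κ₀ κ₁ a c (q j)).δe) ≠ 0)) := by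
    by_cases hc : c < 0
    · exact Or.inl hc
    · exact Or.inr ⟨hκ.2, fun j => goodWalls_hc (hq j) hc⟩
  have hQc : Continuous fun w : Fin 2 → ℝ => (κ₀ : ℝ) * w 0 ^ 2 + κ₁ * w 1 ^ 2 := by fun_prop
  have h1 : ∀ w ∈ closure σ.domain, 0 ≤ w 1 := fun w hw =>
    closure_minimal (fun v hv => show (0 : ℝ) ≤ v 1 from (hσT hv).1.le)
      (isClosed_le continuous_const (continuous_apply 1)) hw
  have h2 : ∀ w ∈ closure σ.domain, w 1 ≤ w 0 := fun w hw =>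
    closure_minimal (fun v hv => show v 1 ≤ v 0 from (hσT hv).2.1.le)
      (isClosed_le (continuous_apply 1) (continuous_apply 0)) hw
  have h3 : ∀ w ∈ closure σ.domain, (κ₀ : ℝ) * w 0 ^ 2 + κ₁ * w 1 ^ 2 ≤ 1 := fun w hw =>
    closure_minimal (fun v hv => show (κ₀ : ℝ) * v 0 ^ 2 + κ₁ * v 1 ^ 2 ≤ 1 from (hσT hv).2.2.le)
      (isClosed_le hQc continuous_const) hw
  exact InBaker.of_psector_cwalls hκ' γ a c ha ℓ' hℓ0 q (fun j => goodWalls_hq (hq j)) hc σ hσo hσT hD hσi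
    isClosed_closure subset_closure (fun w hw => ⟨h1 w hw, h2 w hw, h3 w hw⟩) fun w hwC hwT _ => by
      rcases hfr w hwC hwT with h0 | ⟨i, hg, hi⟩ | ⟨j, hj⟩
      · exact Or.inl h0
      · refine Or.inr (Or.inl ⟨i, ?_⟩)
        rw [show ℓ' i = ℓ i from if_neg fun h => hg.elim (fun hk => hk h.1) fun hk => hk h.2]
        exact hi
      · exact Or.inr (Or.inr ⟨j, hj⟩)

/-! #### 42.3 The regions `{X, Y > 0}`, `{X > 0}`, `{Q < 1}` -/

/-- **STAGE 2: an open piece of the quadrant `{X > 0, Y > 0}`** — cut along `X = Y`, the upper half by the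
swap. [KontsevichZagier2001 §1.2 rules (1)–(2); this node] -/
theorem InBaker.of_Esector2 (hκ : 0 < κ₀ ∧ 0 < κ₁) (γ a c : ℚ) (ha : a ≠ 0) {n m : ℕ} (ℓ : Fin n → Wall)
    (q : Fin m → Wall) (hq : ∀ j, q j ∈ goodWalls κ₀ κ₁ a c) (σ : KZ.IntegralRep 2) (hσo : IsOpen σ.domain)
    (hσT : σ.domain ⊆ {w | 0 < w 0 ∧ 0 < w 1 ∧ (κ₀ : ℝ) * w 0 ^ 2 + κ₁ * w 1 ^ 2 < 1})
    (hD : ∀ w ∈ σ.domain, 0 < erad κ₀ κ₁ a c w)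
    (hσi : ∀ w ∈ σ.domain, σ.integrand w = ellW κ₀ κ₁ γ a c w)
    (hfr : ∀ w ∈ closure σ.domain, w ∉ σ.domain → w ∈ wallLocus (erad κ₀ κ₁ a c) ℓ q) :
    InBaker (KZ.of σ) := by
  set L : Wall := ⟨0, 1, -1⟩ with hLdef
  have hL : L.k1 ≠ 0 ∨ L.k2 ≠ 0 := Or.inl one_ne_zero
  have hLe : ∀ w : Fin 2 → ℝ, L.eval (w 0) (w 1) = w 0 - w 1 := fun w => by
    simp only [hLdef, Wall.eval]; push_cast; ring
  have hb : Bornology.IsBounded σ.domain := isBounded_of_subset_ell hκ fun w hw => (hσT hw).2.2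
  refine InBaker.of_cut L hL σ (fun T hT hTr hTeq => ?_) fun T hT hTr hTeq => ?_
  · -- `Y < X`
    subst hTeq
    refine InBaker.of_Esector3 hκ γ a c ha (Fin.cons L ℓ) q hq (σ.restrict _ hT hTr)
      (hσo.inter (isOpen_lt continuous_const L.continuous_eval)) (fun w hw => ?_) (fun w hw => hD w hw.1)
      (fun w hw => by rw [KZ.IntegralRep.integrand_restrict]; exact hσi w hw.1)
      (wallLocus_inter L hL (closure_pos_wall L) hfr)
    obtain ⟨⟨h0, h1, hQ⟩, hpos⟩ := And.intro (hσT hw.1) hw.2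
    have hpos' : 0 < L.eval (w 0) (w 1) := hpos
    rw [hLe] at hpos'
    exact ⟨h1, by linarith, hQ⟩
  · -- `X < Y`, by the swap
    subst hTeq
    have hTo : IsOpen (σ.domain ∩ {w | L.eval (w 0) (w 1) < 0}) :=
      hσo.inter (isOpen_lt L.continuous_eval continuous_const)
    obtain ⟨τ, hτd, hτi⟩ := exists_ellRep (AffMap.swap.isSemialgebraic_image hT)
      (AffMap.swap.isBounded_image (hb.subset hTr)) κ₁ κ₀ γ a c
    refine InBaker.of_swap κ₀ κ₁ γ a c (σ.restrict _ hT hTr) τ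
      (by rw [hτd, KZ.IntegralRep.domain_restrict])
      (fun w hw => by rw [KZ.IntegralRep.integrand_restrict]; exact hσi w hw.1) hτi ?_
    refine InBaker.of_Esector3 hκ.symm γ a c ha (fun i => ((Fin.cons L ℓ : Fin (n + 1) → Wall) i).swap)
      (fun j => (q j).swap) (fun j => goodWalls_swap (hq j)) τ (by rw [hτd]; exact AffMap.swap.isOpen_image (by simp) hTo)
      ?_ ?_ hτi ?_
    · rw [hτd]
      rintro _ ⟨p, ⟨hp, hneg⟩, rfl⟩
      obtain ⟨h0, h1, hQ⟩ := hσT hp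
      have hneg' : L.eval (p 0) (p 1) < 0 := hneg
      rw [hLe] at hneg'
      simp only [mem_setOf_eq, AffMap.swap_toFun_zero, AffMap.swap_toFun_one]
      exact ⟨h0, by linarith, by linarith⟩
    · rw [hτd]
      rintro _ ⟨p, ⟨hp, -⟩, rfl⟩
      rw [erad_swap]
      exact hD p hp
    · rw [hτd]
      exact wallLocus_transport AffMap.swap (by simp) (erad_swap κ₀ κ₁ a c)
        (fun i p => ((Fin.cons L ℓ : Fin (n + 1) → Wall) i).swap_eval p)
        (fun i hg => Wall.swap_gen _ hg) (fun j p => (q j).swap_eval p)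
        (wallLocus_inter L hL (closure_neg_wall L) hfr)

/-- **STAGE 1: an open piece of the half-plane `{X > 0}`** — cut along `Y = 0`, the lower half by `negY`.
[KontsevichZagier2001 §1.2 rules (1)–(2); this node] -/
theorem InBaker.of_Esector1 (hκ : 0 < κ₀ ∧ 0 < κ₁) (γ a c : ℚ) (ha : a ≠ 0) {n m : ℕ} (ℓ : Fin n → Wall)
    (q : Fin m → Wall) (hq : ∀ j, q j ∈ goodWalls κ₀ κ₁ a c) (σ : KZ.IntegralRep 2) (hσo : IsOpen σ.domain)
    (hσT : σ.domain ⊆ {w | 0 < w 0 ∧ (κ₀ : ℝ) * w 0 ^ 2 + κ₁ * w 1 ^ 2 < 1})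
    (hD : ∀ w ∈ σ.domain, 0 < erad κ₀ κ₁ a c w)
    (hσi : ∀ w ∈ σ.domain, σ.integrand w = ellW κ₀ κ₁ γ a c w)
    (hfr : ∀ w ∈ closure σ.domain, w ∉ σ.domain → w ∈ wallLocus (erad κ₀ κ₁ a c) ℓ q) :
    InBaker (KZ.of σ) := by
  set L : Wall := ⟨0, 0, 1⟩ with hLdef
  have hL : L.k1 ≠ 0 ∨ L.k2 ≠ 0 := Or.inr one_ne_zero
  have hLe : ∀ w : Fin 2 → ℝ, L.eval (w 0) (w 1) = w 1 := fun w => by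
    simp only [hLdef, Wall.eval]; push_cast; ring
  have hb : Bornology.IsBounded σ.domain := isBounded_of_subset_ell hκ fun w hw => (hσT hw).2
  refine InBaker.of_cut L hL σ (fun T hT hTr hTeq => ?_) fun T hT hTr hTeq => ?_
  · -- `Y > 0`
    subst hTeq
    refine InBaker.of_Esector2 hκ γ a c ha (Fin.cons L ℓ) q hq (σ.restrict _ hT hTr)
      (hσo.inter (isOpen_lt continuous_const L.continuous_eval)) (fun w hw => ?_) (fun w hw => hD w hw.1)
      (fun w hw => by rw [KZ.IntegralRep.integrand_restrict]; exact hσi w hw.1)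
      (wallLocus_inter L hL (closure_pos_wall L) hfr)
    obtain ⟨⟨h0, hQ⟩, hpos⟩ := And.intro (hσT hw.1) hw.2
    have hpos' : 0 < L.eval (w 0) (w 1) := hpos
    rw [hLe] at hpos'
    exact ⟨h0, hpos', hQ⟩
  · -- `Y < 0`, by `negY`
    subst hTeq
    have hTo : IsOpen (σ.domain ∩ {w | L.eval (w 0) (w 1) < 0}) :=
      hσo.inter (isOpen_lt L.continuous_eval continuous_const)
    obtain ⟨τ, hτd, hτi⟩ := exists_ellRep (AffMap.negY.isSemialgebraic_image hT)
      (AffMap.negY.isBounded_image (hb.subset hTr)) κ₀ κ₁ γ a c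
    refine InBaker.of_negY κ₀ κ₁ γ a c (σ.restrict _ hT hTr) τ
      (by rw [hτd, KZ.IntegralRep.domain_restrict])
      (fun w hw => by rw [KZ.IntegralRep.integrand_restrict]; exact hσi w hw.1) hτi ?_
    refine InBaker.of_Esector2 hκ γ a c ha (fun i => ((Fin.cons L ℓ : Fin (n + 1) → Wall) i).negY)
      (fun j => (q j).negY) (fun j => goodWalls_negY (hq j)) τ
      (by rw [hτd]; exact AffMap.negY.isOpen_image (by simp) hTo) ?_ ?_ hτi ?_
    · rw [hτd]
      rintro _ ⟨p, ⟨hp, hneg⟩, rfl⟩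
      obtain ⟨h0, hQ⟩ := hσT hp
      have hneg' : L.eval (p 0) (p 1) < 0 := hneg
      rw [hLe] at hneg'
      simp only [mem_setOf_eq, AffMap.negY_toFun_zero, AffMap.negY_toFun_one, neg_sq]
      exact ⟨h0, by linarith, hQ⟩
    · rw [hτd]
      rintro _ ⟨p, ⟨hp, -⟩, rfl⟩
      rw [erad_negY]
      exact hD p hp
    · rw [hτd]
      exact wallLocus_transport AffMap.negY (by simp) (erad_negY κ₀ κ₁ a c)
        (fun i p => ((Fin.cons L ℓ : Fin (n + 1) → Wall) i).negY_eval p)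
        (fun i hg => Wall.negY_gen _ hg) (fun j p => (q j).negY_eval p)
        (wallLocus_inter L hL (closure_neg_wall L) hfr)

/-- **STAGE 0: an open piece of `{κ₀X² + κ₁Y² < 1}`** — cut along `X = 0`, the left half by `negX`.
[KontsevichZagier2001 §1.2 rules (1)–(2); this node] -/
theorem InBaker.of_Esector0 (hκ : 0 < κ₀ ∧ 0 < κ₁) (γ a c : ℚ) (ha : a ≠ 0) {n m : ℕ} (ℓ : Fin n → Wall)
    (q : Fin m → Wall) (hq : ∀ j, q j ∈ goodWalls κ₀ κ₁ a c) (σ : KZ.IntegralRep 2) (hσo : IsOpen σ.domain)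
    (hσT : σ.domain ⊆ {w | (κ₀ : ℝ) * w 0 ^ 2 + κ₁ * w 1 ^ 2 < 1})
    (hD : ∀ w ∈ σ.domain, 0 < erad κ₀ κ₁ a c w)
    (hσi : ∀ w ∈ σ.domain, σ.integrand w = ellW κ₀ κ₁ γ a c w)
    (hfr : ∀ w ∈ closure σ.domain, w ∉ σ.domain → w ∈ wallLocus (erad κ₀ κ₁ a c) ℓ q) :
    InBaker (KZ.of σ) := by
  set L : Wall := ⟨0, 1, 0⟩ with hLdef
  have hL : L.k1 ≠ 0 ∨ L.k2 ≠ 0 := Or.inl one_ne_zero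
  have hLe : ∀ w : Fin 2 → ℝ, L.eval (w 0) (w 1) = w 0 := fun w => by
    simp only [hLdef, Wall.eval]; push_cast; ring
  have hb : Bornology.IsBounded σ.domain := isBounded_of_subset_ell hκ hσT
  refine InBaker.of_cut L hL σ (fun T hT hTr hTeq => ?_) fun T hT hTr hTeq => ?_
  · -- `X > 0`
    subst hTeq
    refine InBaker.of_Esector1 hκ γ a c ha (Fin.cons L ℓ) q hq (σ.restrict _ hT hTr)
      (hσo.inter (isOpen_lt continuous_const L.continuous_eval)) (fun w hw => ?_) (fun w hw => hD w hw.1)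
      (fun w hw => by rw [KZ.IntegralRep.integrand_restrict]; exact hσi w hw.1)
      (wallLocus_inter L hL (closure_pos_wall L) hfr)
    have hpos' : 0 < L.eval (w 0) (w 1) := hw.2
    rw [hLe] at hpos'
    exact ⟨hpos', hσT hw.1⟩
  · -- `X < 0`, by `negX`
    subst hTeq
    have hTo : IsOpen (σ.domain ∩ {w | L.eval (w 0) (w 1) < 0}) :=
      hσo.inter (isOpen_lt L.continuous_eval continuous_const)
    obtain ⟨τ, hτd, hτi⟩ := exists_ellRep (AffMap.negX.isSemialgebraic_image hT)
      (AffMap.negX.isBounded_image (hb.subset hTr)) κ₀ κ₁ γ a c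
    refine InBaker.of_negX κ₀ κ₁ γ a c (σ.restrict _ hT hTr) τ
      (by rw [hτd, KZ.IntegralRep.domain_restrict])
      (fun w hw => by rw [KZ.IntegralRep.integrand_restrict]; exact hσi w hw.1) hτi ?_
    refine InBaker.of_Esector1 hκ γ a c ha (fun i => ((Fin.cons L ℓ : Fin (n + 1) → Wall) i).negX)
      (fun j => (q j).negX) (fun j => goodWalls_negX (hq j)) τ
      (by rw [hτd]; exact AffMap.negX.isOpen_image (by simp) hTo) ?_ ?_ hτi ?_
    · rw [hτd]
      rintro _ ⟨p, ⟨hp, hneg⟩, rfl⟩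
      have hQ := hσT hp
      have hneg' : L.eval (p 0) (p 1) < 0 := hneg
      rw [hLe] at hneg'
      simp only [mem_setOf_eq, AffMap.negX_toFun_zero, AffMap.negX_toFun_one, neg_sq] at hQ ⊢
      exact ⟨by linarith, hQ⟩
    · rw [hτd]
      rintro _ ⟨p, ⟨hp, -⟩, rfl⟩
      rw [erad_negX]
      exact hD p hp
    · rw [hτd]
      exact wallLocus_transport AffMap.negX (by simp) (erad_negX κ₀ κ₁ a c)
        (fun i p => ((Fin.cons L ℓ : Fin (n + 1) → Wall) i).negX_eval p)
        (fun i hg => Wall.negX_gen _ hg) (fun j p => (q j).negX_eval p)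
        (wallLocus_inter L hL (closure_neg_wall L) hfr)

/-! #### 42.4 Bounded pieces: the rational dilation -/

/-- **E-TYPE PLANE THEOREM (normal frame).**  For `κ₀, κ₁ > 0`, `a ≠ 0` and a BOUNDED open
`ℚ`-semialgebraic `U` on which `a(κ₀X² + κ₁Y²) + c > 0`, whose frontier lies on the radicand conic, on
genuine rational lines `ℓ i` and on good adapted conic walls `a(κ₀X² + κ₁Y²) + c = (q j)²`:
`[U, γ√(a(κ₀X² + κ₁Y²) + c)] ∈ InBaker`.  A rational dilation `1/N` brings `U` inside `{Q < 1}`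
(`(γ, a, walls) ↦ (γN², aN², scaled walls)`, `goodWalls_scale`), then `InBaker.of_Esector0`.
[KontsevichZagier2001 §1.2 rules (1)–(3); this node] -/
theorem InBaker.of_Eplane (hκ : 0 < κ₀ ∧ 0 < κ₁) (γ a c : ℚ) (ha : a ≠ 0) {n m : ℕ} (ℓ : Fin n → Wall)
    (q : Fin m → Wall) (hq : ∀ j, q j ∈ goodWalls κ₀ κ₁ a c) (σ : KZ.IntegralRep 2) (hσo : IsOpen σ.domain)
    (hσb : Bornology.IsBounded σ.domain) (hD : ∀ w ∈ σ.domain, 0 < erad κ₀ κ₁ a c w)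
    (hσi : ∀ w ∈ σ.domain, σ.integrand w = ellW κ₀ κ₁ γ a c w)
    (hfr : ∀ w ∈ closure σ.domain, w ∉ σ.domain → w ∈ wallLocus (erad κ₀ κ₁ a c) ℓ q) :
    InBaker (KZ.of σ) := by
  have hκ0 : (0 : ℝ) < κ₀ := by exact_mod_cast hκ.1
  have hκ1 : (0 : ℝ) < κ₁ := by exact_mod_cast hκ.2
  obtain ⟨R, hR⟩ := isBounded_iff_forall_norm_le.1 hσb
  have hw : ∀ w ∈ σ.domain, ∀ j, |w j| ≤ R := fun w hw j => by
    rw [← Real.norm_eq_abs]; exact (norm_le_pi_norm w j).trans (hR w hw)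
  obtain ⟨N, hN⟩ := exists_nat_gt (((κ₀ : ℝ) + κ₁) * R ^ 2)
  have hN0 : (0 : ℝ) < N := lt_of_le_of_lt (by positivity) hN
  have hN1 : (1 : ℝ) ≤ N := by
    exact_mod_cast Nat.one_le_iff_ne_zero.2 (by rintro rfl; simp at hN0)
  have hNq : (N : ℚ) ≠ 0 := by exact_mod_cast hN0.ne'
  have htl : (N : ℚ) * (1 / N) = 1 := by field_simp
  have hl0 : (1 / N : ℚ) ≠ 0 := one_div_ne_zero hNq
  have hdet : (AffMap.dil (1 / N : ℚ)).det ≠ 0 := by rw [AffMap.dil_det]; exact pow_ne_zero 2 hl0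
  have hlR : ((1 / N : ℚ) : ℝ) = 1 / N := by rw [Rat.cast_div, Rat.cast_one, Rat.cast_natCast]
  -- the dilated piece
  obtain ⟨τ, hτd, hτi⟩ := exists_ellRep
    ((AffMap.dil (1 / N : ℚ)).isSemialgebraic_image σ.isSemialgebraic_domain)
    ((AffMap.dil (1 / N : ℚ)).isBounded_image hσb) κ₀ κ₁ (γ * N ^ 2) (a * N ^ 2) c
  have hγ : γ * (N : ℚ) ^ 2 * (1 / N) ^ 2 = γ := by field_simp
  have ha2 : a * (N : ℚ) ^ 2 * (1 / N) ^ 2 = a := by field_simp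
  refine InBaker.of_dil κ₀ κ₁ (γ * N ^ 2) (a * N ^ 2) c (1 / N) hl0 σ τ hτd
    (fun p hp => by rw [hγ, ha2]; exact hσi p hp) hτi ?_
  refine InBaker.of_Esector0 hκ (γ * N ^ 2) (a * N ^ 2) c (mul_ne_zero ha (pow_ne_zero 2 hNq))
    (fun i => (ℓ i).scale N) (fun j => (q j).scale N) (fun j => goodWalls_scale hNq (hq j)) τ
    (by rw [hτd]; exact (AffMap.dil (1 / N : ℚ)).isOpen_image hdet hσo) ?_ ?_ hτi ?_
  · rw [hτd]
    rintro _ ⟨p, hp, rfl⟩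
    have h0 : p 0 ^ 2 ≤ R ^ 2 := sq_le_sq' (abs_le.1 (hw p hp 0)).1 (abs_le.1 (hw p hp 0)).2
    have h1 : p 1 ^ 2 ≤ R ^ 2 := sq_le_sq' (abs_le.1 (hw p hp 1)).1 (abs_le.1 (hw p hp 1)).2
    have hQ : (κ₀ : ℝ) * p 0 ^ 2 + κ₁ * p 1 ^ 2 ≤ (κ₀ + κ₁) * R ^ 2 := by nlinarith
    simp only [mem_setOf_eq, AffMap.dil_toFun_zero, AffMap.dil_toFun_one, hlR]
    rw [show (κ₀ : ℝ) * (1 / N * p 0) ^ 2 + κ₁ * (1 / N * p 1) ^ 2 =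
      ((κ₀ : ℝ) * p 0 ^ 2 + κ₁ * p 1 ^ 2) / (N : ℝ) ^ 2 by field_simp]
    rw [div_lt_one (by positivity)]
    nlinarith
  · rw [hτd]
    rintro _ ⟨p, hp, rfl⟩
    rw [erad_dil κ₀ κ₁ a c N (1 / N) htl]
    exact hD p hp
  · rw [hτd]
    exact wallLocus_transport (AffMap.dil (1 / N : ℚ)) hdet (erad_dil κ₀ κ₁ a c N (1 / N) htl)
      (fun i p => (ℓ i).scale_eval N (1 / N) htl p) (fun i hg => Wall.scale_gen _ hNq hg)
      (fun j p => (q j).scale_eval N (1 / N) htl p) hfr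

end Summit.KontsevichZagierPeriods.RootDecompWalshStrata.ConicDescent.BallCube

end
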